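import Literature.Analysis.FluidPDE.SelfSimilar
import Literature.Analysis.FluidPDE.PressurePoisson
import Literature.Analysis.FluidPDE.TaoEnstrophyLocalisationProofs
import HarnessLib

/-!
# Pointwise calculus for Leray's profile system: `tr (L²) ≤ |L|²`, `Δ⟪F, G⟫`, and the pressure
  Poisson equation `ΔP = −tr (DU ∘ DU)` of a Leray profile

Analysis/FluidPDE support file (theorems only) for the decomposition of the named facts
`Literature.Analysis.FluidPDE.tsai_selfsimilar` and
`Literature.Analysis.FluidPDE.tsai_selfsimilar_local_energy` (`FluidPDE/SelfSimilarLiouville`;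
T.-P. Tsai, *On Leray's self-similar solutions of the Navier–Stokes equations satisfying local
energy estimates*, Arch. Rational Mech. Anal. 143 (1998), Theorems 1 and 2). The endgame of
Tsai's proofs (§5, pp. 48–49) is a computation with the head pressure
`Π = ½|U|² + P + a y·U` of a profile `(U, P)` of Leray's system
`−νΔU + aU + a(y·∇)U + (U·∇)U + ∇P = 0`, `div U = 0` (the accepted pointwise class
`Literature.Analysis.FluidPDE.IsLerayProfile`); this file supplies the coordinate-free pointwise
identities it needs, on a finite-dimensional real inner product space `E`:

* **Linear algebra** (`E →L[ℝ] E`, orthonormal basis `b`, `|·|` the Frobenius norm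
  `Literature.Analysis.FluidPDE.frobeniusNormSq`, `tr` the trace `traceCLM`):
  `|L|² = Σᵢⱼ ⟪bᵢ, L bⱼ⟫²`, `tr (L L) = Σᵢⱼ ⟪bᵢ, L bⱼ⟫⟪bⱼ, L bᵢ⟫`,
  **`|L − L†|² = 2 (|L|² − tr (L L))`** (`frobeniusNormSq_sub_adjoint`), hence `tr (L L) ≤ |L|²`
  with equality iff `L` is symmetric (`inner_map_comm_of_traceCLM_comp_self_eq`). For `L = DU(y)`
  the left-hand side is `|DU − DUᵀ|² = 2|curl U|²` on `ℝ³`: this is how `|Ω|²` enters (1.7).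
* **Laplacian of an inner product**: `Δ⟪F, G⟫ = ⟪ΔF, G⟫ + ⟪F, ΔG⟫ + 2 Σᵢ ⟪∂ᵢF, ∂ᵢG⟫`
  (`laplacian_inner_eq`), whence `Δ|U|² = 2⟪ΔU, U⟫ + 2|DU|²` (Tsai 1998, proof of Lemma 3.1:
  `−U·ΔU = |∇U|² − ½Δ|U|²`) and `Δ⟪y, U⟫ = ⟪y, ΔU⟫ + 2 div U`; `Δ (y ↦ y) = 0`, `Δ const = 0`.
* **Profiles**: `div (y ↦ DU(y) y) = 0` and `div ((U·∇)U) = tr (DU ∘ DU)` for divergence-free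
  `C²` fields, and for a Leray profile with `U ∈ C³`, `P ∈ C²` the **pressure Poisson equation**
  `ΔP = −tr (DU ∘ DU)` (Tsai 1998, (2.1): `−ΔP = Σ ∂ᵢ∂ⱼ(UᵢUⱼ)`; take the divergence of the system,
  `div ΔU = Δ div U = 0`, `div (y·∇U) = div U + y·∇ div U = 0`), `IsLerayProfile.laplacian_pressure_eq`;
  the pressure of a profile with `U ∈ C³` is `C²` (`IsLerayProfile.contDiff_two_pressure`,
  `∇P = νΔU − aU − a(y·∇)U − (U·∇)U ∈ C¹`; Tsai 1998, p. 34: "since `U` is smooth, `P` is also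
  smooth"); `ΔU ∈ C¹` for `U ∈ C³`.
* **Growth bookkeeping**: an eventual linear bound `|U(y)| ≤ b|y|` (`|y| ≥ r₀`) on a continuous
  field gives an affine bound `|U| ≤ M + b|y|`; an eventual bound `|P(y)| ≤ C|y|^N` on a continuous
  function gives `|P| ≤ C'(1 + |y|)^N` everywhere.

Everything here is proved; no definitions, no named facts. The head pressure itself, identity
(1.7) and the endgame are in `FluidPDE/TsaiProfileEndgame`.

## Mathlib / tree search

Mathlib (this pin) has the Laplacian `InnerProductSpace.laplacian` (`Δ`, with `laplacian_add/smul`,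
`laplacian_eq_iteratedFDeriv_orthonormalBasis`), `LinearMap.trace_eq_sum_inner`,
`OrthonormalBasis.sum_repr'`, `OrthonormalBasis.sum_sq_inner_right`,
`ContinuousLinearMap.adjoint_inner_right`, `fderiv_inner_apply`, `ContDiffAt.isSymmSndFDerivAt`,
`contDiff_succ_iff_fderiv`; no Leibniz rule for `Δ` of a product/inner product and no
`tr (L²) ≤ ‖L‖²_HS` (`lean search 'laplacian_inner'`, `'trace_comp_self'`, `'frobenius'`: tree only).
Tree: `laplacian_eq_sum_fderiv_fderiv` (`WholeSpaceIBP`), `laplacian_mul_eq` (scalar Leibniz rule,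
`HessianLaplacian`, not imported), `traceCLM`, `fderiv_divergence_apply`,
`divergence_smul_convect_sub` (`TaoEnstrophyLocalisationProofs`), `divergence_gradient`,
`divergence_laplacian_eq_zero`, `differentiable_laplacian` (`PressurePoisson`),
`frobeniusNormSq(_eq_sum)`, `spin`, `convect`, `VectorCalculus.divergence` (`VectorCalculus`),
`IsLerayProfile` (`SelfSimilar`).

## References

* T.-P. Tsai, *On Leray's self-similar solutions of the Navier–Stokes equations satisfying local
  energy estimates*, Arch. Rational Mech. Anal. 143 (1998) 29–51: (1.7) p. 31, (2.1) p. 34,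
  proof of Lemma 3.1 p. 37, §5 pp. 48–49 [Tsai1998].
* J. Nečas, M. Růžička, V. Šverák, *On Leray's self-similar solutions of the Navier–Stokes
  equations*, Acta Math. 176 (1996) 283–294, (2.9)–(2.11) [NecasRuzickaSverak1996].
-/

noncomputable section

open MeasureTheory Set Function Filter Topology InnerProductSpace Metric
open scoped RealInnerProductSpace Laplacian ContDiff NNReal ENNReal

namespace Literature.Analysis.FluidPDE

/-! ## Linear algebra: `tr (L L) ≤ |L|²`, with equality iff `L` is symmetric -/

section LinearAlgebra

variable {E : Type*} [NormedAddCommGroup E] [InnerProductSpace ℝ E] [FiniteDimensional ℝ E]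

/-- The Frobenius norm in matrix entries: `|L|² = Σᵢ Σⱼ ⟪bᵢ, L bⱼ⟫²`. [folklore] -/
theorem frobeniusNormSq_eq_sum_sum_sq_inner {ι : Type*} [Fintype ι] (b : OrthonormalBasis ι ℝ E)
    (L : E →L[ℝ] E) : frobeniusNormSq L = ∑ i, ∑ j, ⟪b i, L (b j)⟫ ^ 2 := by
  rw [frobeniusNormSq_eq_sum b, Finset.sum_comm]
  exact Finset.sum_congr rfl fun j _ => (b.sum_sq_inner_right (L (b j))).symm

/-- The trace of `L ∘ L` in matrix entries: `tr (L L) = Σᵢ Σⱼ ⟪bᵢ, L bⱼ⟫ ⟪bⱼ, L bᵢ⟫`. [folklore] -/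
theorem traceCLM_comp_self_eq_sum_sum {ι : Type*} [Fintype ι] (b : OrthonormalBasis ι ℝ E)
    (L : E →L[ℝ] E) : traceCLM (L.comp L) = ∑ i, ∑ j, ⟪b i, L (b j)⟫ * ⟪b j, L (b i)⟫ := by
  rw [traceCLM_eq_sum_inner b]
  refine Finset.sum_congr rfl fun i _ => ?_
  calc ⟪b i, (L.comp L) (b i)⟫ = ⟪b i, L (∑ j, ⟪b j, L (b i)⟫ • b j)⟫ := by
        rw [ContinuousLinearMap.comp_apply, b.sum_repr']
    _ = ∑ j, ⟪b i, L (b j)⟫ * ⟪b j, L (b i)⟫ := by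
        rw [map_sum, inner_sum]
        exact Finset.sum_congr rfl fun j _ => by rw [map_smul, real_inner_smul_right, mul_comm]

/-- A map with vanishing Frobenius norm is zero. [folklore] -/
theorem eq_zero_of_frobeniusNormSq_eq_zero {A : E →L[ℝ] E} (h : frobeniusNormSq A = 0) : A = 0 := by
  set b := stdOrthonormalBasis ℝ E
  rw [frobeniusNormSq_eq_sum b] at h
  have hb : ∀ i, A (b i) = 0 := by
    intro i
    have := (Finset.sum_eq_zero_iff_of_nonneg fun j _ => sq_nonneg ‖A (b j)‖).1 h i (Finset.mem_univ i)
    exact norm_eq_zero.1 (pow_eq_zero_iff two_ne_zero |>.1 this)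
  ext v
  rw [← b.sum_repr' v, map_sum]
  simp [map_smul, hb]

variable [CompleteSpace E]

omit [FiniteDimensional ℝ E] in
/-- Matrix entries of `L - L†`: `⟪v, (L - L†) w⟫ = ⟪v, L w⟫ - ⟪w, L v⟫`. [folklore] -/
theorem inner_sub_adjoint_apply (L : E →L[ℝ] E) (v w : E) :
    ⟪v, (L - ContinuousLinearMap.adjoint L) w⟫ = ⟪v, L w⟫ - ⟪w, L v⟫ := by
  rw [_root_.sub_apply, inner_sub_right,
    ContinuousLinearMap.adjoint_inner_right, real_inner_comm (L v)]

/-- **`|L - L†|² = 2 (|L|² - tr (L L))`** (Frobenius norms): the antisymmetric part of `L`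
measures the defect in `tr (L²) ≤ |L|²`. [folklore] -/
theorem frobeniusNormSq_sub_adjoint (L : E →L[ℝ] E) :
    frobeniusNormSq (L - ContinuousLinearMap.adjoint L) =
      2 * (frobeniusNormSq L - traceCLM (L.comp L)) := by
  set b := stdOrthonormalBasis ℝ E
  rw [frobeniusNormSq_eq_sum_sum_sq_inner b, frobeniusNormSq_eq_sum_sum_sq_inner b,
    traceCLM_comp_self_eq_sum_sum b]
  simp_rw [inner_sub_adjoint_apply]
  have h1 : ∑ i, ∑ j, (⟪b i, L (b j)⟫ - ⟪b j, L (b i)⟫) ^ 2 =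
      ∑ i, ∑ j, (⟪b i, L (b j)⟫ ^ 2 + ⟪b j, L (b i)⟫ ^ 2 - 2 * (⟪b i, L (b j)⟫ * ⟪b j, L (b i)⟫)) :=
    Finset.sum_congr rfl fun i _ => Finset.sum_congr rfl fun j _ => by ring
  have h2 : ∑ i, ∑ j, ⟪b j, L (b i)⟫ ^ 2 = ∑ i, ∑ j, ⟪b i, L (b j)⟫ ^ 2 := Finset.sum_comm
  rw [h1]
  simp only [Finset.sum_sub_distrib, Finset.sum_add_distrib, ← Finset.mul_sum]
  rw [h2]
  ring

/-- **`tr (L L) ≤ |L|²`** for every endomorphism of a finite-dimensional inner product space. [folklore] -/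
theorem traceCLM_comp_self_le_frobeniusNormSq (L : E →L[ℝ] E) :
    traceCLM (L.comp L) ≤ frobeniusNormSq L := by
  have h := frobeniusNormSq_sub_adjoint L
  have h0 := frobeniusNormSq_nonneg (L - ContinuousLinearMap.adjoint L)
  linarith

/-- **Equality `tr (L L) = |L|²` forces symmetry**: then `L† = L`, i.e. `⟪L v, w⟫ = ⟪v, L w⟫`. [folklore] -/
theorem inner_map_comm_of_traceCLM_comp_self_eq {L : E →L[ℝ] E}
    (h : traceCLM (L.comp L) = frobeniusNormSq L) (v w : E) : ⟪L v, w⟫ = ⟪v, L w⟫ := by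
  have h2 : frobeniusNormSq (L - ContinuousLinearMap.adjoint L) = 0 := by
    rw [frobeniusNormSq_sub_adjoint, h, sub_self, mul_zero]
  have h3 : L - ContinuousLinearMap.adjoint L = 0 := eq_zero_of_frobeniusNormSq_eq_zero h2
  have h4 : ContinuousLinearMap.adjoint L = L := (sub_eq_zero.1 h3).symm
  rw [← ContinuousLinearMap.adjoint_inner_right, h4]

end LinearAlgebra

/-! ## The Laplacian of an inner product -/

section Calculus

variable {E : Type*} [NormedAddCommGroup E] [InnerProductSpace ℝ E] [FiniteDimensional ℝ E]
variable {F' : Type*} [NormedAddCommGroup F'] [InnerProductSpace ℝ F']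

/-- **Leibniz rule for the Laplacian of an inner product**: for `C²` fields `F, G : E → F'` and an
orthonormal basis `b` of `E`, `Δ⟪F, G⟫ = ⟪ΔF, G⟫ + ⟪F, ΔG⟫ + 2 Σᵢ ⟪∂ᵢF, ∂ᵢG⟫`. [folklore] -/
theorem laplacian_inner_eq {ι : Type*} [Fintype ι] (b : OrthonormalBasis ι ℝ E) {F G : E → F'}
    (hF : ContDiff ℝ 2 F) (hG : ContDiff ℝ 2 G) (x : E) :
    (Δ fun y => ⟪F y, G y⟫) x =
      ⟪(Δ F) x, G x⟫ + ⟪F x, (Δ G) x⟫ + 2 * ∑ i, ⟪fderiv ℝ F x (b i), fderiv ℝ G x (b i)⟫ := by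
  have hF1 : ContDiff ℝ 1 F := hF.of_le one_le_two
  have hG1 : ContDiff ℝ 1 G := hG.of_le one_le_two
  have hFd : ∀ y, DifferentiableAt ℝ F y := fun y => hF1.differentiable one_ne_zero y
  have hGd : ∀ y, DifferentiableAt ℝ G y := fun y => hG1.differentiable one_ne_zero y
  have hFa : ∀ c, ContDiff ℝ 1 fun y => fderiv ℝ F y c := fun c =>
    (hF.fderiv_right (m := 1) le_rfl).clm_apply contDiff_const
  have hGa : ∀ c, ContDiff ℝ 1 fun y => fderiv ℝ G y c := fun c =>
    (hG.fderiv_right (m := 1) le_rfl).clm_apply contDiff_const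
  rw [laplacian_eq_sum_fderiv_fderiv b (hF.inner ℝ hG) x, laplacian_eq_sum_fderiv_fderiv b hF x,
    laplacian_eq_sum_fderiv_fderiv b hG x, sum_inner, inner_sum, Finset.mul_sum,
    ← Finset.sum_add_distrib, ← Finset.sum_add_distrib]
  refine Finset.sum_congr rfl fun i _ => ?_
  have h1 : (fun y => fderiv ℝ (fun y => ⟪F y, G y⟫) y (b i)) =
      fun y => ⟪F y, fderiv ℝ G y (b i)⟫ + ⟪fderiv ℝ F y (b i), G y⟫ := by
    funext y
    exact fderiv_inner_apply ℝ (hFd y) (hGd y) (b i)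
  rw [h1]
  have hA : DifferentiableAt ℝ (fun y => ⟪F y, fderiv ℝ G y (b i)⟫) x :=
    (hFd x).inner ℝ ((hGa (b i)).differentiable one_ne_zero x)
  have hB : DifferentiableAt ℝ (fun y => ⟪fderiv ℝ F y (b i), G y⟫) x :=
    ((hFa (b i)).differentiable one_ne_zero x).inner ℝ (hGd x)
  rw [fderiv_fun_add hA hB, _root_.add_apply,
    fderiv_inner_apply ℝ (hFd x) ((hGa (b i)).differentiable one_ne_zero x),
    fderiv_inner_apply ℝ ((hFa (b i)).differentiable one_ne_zero x) (hGd x)]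
  ring

/-- `Δ (y ↦ y) = 0`. [folklore] -/
theorem laplacian_id_eq_zero (x : E) : (Δ fun y : E => y) x = 0 := by
  set b := stdOrthonormalBasis ℝ E
  have hid : ContDiff ℝ 2 fun y : E => y := contDiff_id
  rw [laplacian_eq_sum_fderiv_fderiv b hid x]
  refine Finset.sum_eq_zero fun i _ => ?_
  have : (fun y : E => fderiv ℝ (fun y : E => y) y (b i)) = fun _ => b i := by
    funext y
    rw [fderiv_fun_id]
    rfl
  rw [this, fderiv_fun_const]
  rfl

/-- The Laplacian of a constant vanishes. [folklore] -/
theorem laplacian_const_eq_zero (c : F')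
    (x : E) : (Δ fun _ : E => c) x = 0 := by
  have hc : ContDiff ℝ 2 fun _ : E => c := contDiff_const
  rw [laplacian_eq_sum_fderiv_fderiv (stdOrthonormalBasis ℝ E) hc x]
  simp

/-- **`Δ |U|² = 2 ⟪ΔU, U⟫ + 2 |DU|²`** for a `C²` field `U : E → E` (`−U·ΔU = |∇U|² − ½Δ|U|²`,
Tsai 1998, proof of Lemma 3.1). [cite: Tsai1998, proof of Lemma 3.1 (p. 37)] -/
theorem laplacian_inner_self_eq {U : E → E} (hU : ContDiff ℝ 2 U) (x : E) :
    (Δ fun y => ⟪U y, U y⟫) x = 2 * ⟪(Δ U) x, U x⟫ + 2 * frobeniusNormSq (fderiv ℝ U x) := by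
  set b := stdOrthonormalBasis ℝ E
  rw [laplacian_inner_eq b hU hU x, frobeniusNormSq_eq_sum b, real_inner_comm (U x)]
  have : ∑ i, ⟪fderiv ℝ U x (b i), fderiv ℝ U x (b i)⟫ = ∑ i, ‖fderiv ℝ U x (b i)‖ ^ 2 :=
    Finset.sum_congr rfl fun i _ => real_inner_self_eq_norm_sq _
  rw [this]
  ring

/-- **`Δ ⟪y, U⟫ = ⟪y, ΔU⟫ + 2 div U`** for a `C²` field `U : E → E`. [folklore] -/
theorem laplacian_inner_id_eq {U : E → E} (hU : ContDiff ℝ 2 U) (x : E) :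
    (Δ fun y => ⟪y, U y⟫) x = ⟪x, (Δ U) x⟫ + 2 * VectorCalculus.divergence U x := by
  set b := stdOrthonormalBasis ℝ E
  have hid : ContDiff ℝ 2 fun y : E => y := contDiff_id
  rw [laplacian_inner_eq b hid hU x, laplacian_id_eq_zero, inner_zero_left, zero_add,
    divergence_eq_sum_inner_fderiv b]
  congr 2
  refine Finset.sum_congr rfl fun i _ => ?_
  rw [fderiv_fun_id]
  rfl

end Calculus

/-! ## Leray profiles: the pressure Poisson equation and the regularity of the pressure -/

section Profiles

variable {E : Type*} [NormedAddCommGroup E] [InnerProductSpace ℝ E] [FiniteDimensional ℝ E]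

/-- **The divergence of `y ↦ DU(y) y` vanishes for a divergence-free `C²` field** (it equals
`div U + y·∇(div U)`). [folklore] -/
theorem divergence_fderiv_apply_self_eq_zero {U : E → E} (hU : ContDiff ℝ 2 U)
    (hdiv : VectorCalculus.IsDivFree U) (y : E) :
    VectorCalculus.divergence (fun x => fderiv ℝ U x x) y = 0 := by
  have hDUd : Differentiable ℝ (fderiv ℝ U) :=
    (hU.fderiv_right (m := 1) le_rfl).differentiable one_ne_zero
  have hdiv0 : VectorCalculus.divergence U = fun _ => (0 : ℝ) := funext hdiv
  rw [divergence_eq_traceCLM, fderiv_clm_apply (hDUd y) differentiableAt_fun_id, map_add,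
    fderiv_fun_id, ContinuousLinearMap.comp_id, ← divergence_eq_traceCLM, hdiv y, zero_add]
  have hsymm : traceCLM ((fderiv ℝ (fderiv ℝ U) y).flip y) =
      fderiv ℝ (VectorCalculus.divergence U) y y := by
    rw [fderiv_divergence_apply hU]
    congr 1
    ext u
    simp only [ContinuousLinearMap.flip_apply]
    exact (hU.contDiffAt.isSymmSndFDerivAt (n := 2) (by simp)) u y
  rw [hsymm, hdiv0]
  simp

/-- **`div ((U·∇)U) = tr (DU ∘ DU)` for a divergence-free `C²` field.** [folklore] -/
theorem divergence_convect_self_eq {U : E → E} (hU : ContDiff ℝ 2 U) (hdiv : VectorCalculus.IsDivFree U)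
    (y : E) :
    VectorCalculus.divergence (convect U U) y = traceCLM ((fderiv ℝ U y).comp (fderiv ℝ U y)) := by
  have key := divergence_smul_convect_sub U hU (contDiff_const (c := (1 : ℝ))) y
  have hfun : (fun x => (1 : ℝ) • (fderiv ℝ U x (U x) - VectorCalculus.divergence U x • U x)) =
      convect U U := by
    funext x
    simp [hdiv x, convect]
  rw [hfun] at key
  rw [key, hdiv y]
  simp

/-- **The pressure Poisson equation of a Leray profile**: `ΔP = −tr (DU ∘ DU)` (take the
divergence of the profile system; `div ΔU = 0`, `div U = 0`, `div (y·∇U) = 0`). Needs `U ∈ C³`,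
`P ∈ C²`. [cite: Tsai1998, (2.1) (p. 34)] -/
theorem IsLerayProfile.laplacian_pressure_eq {ν a : ℝ} {U : E → E} {P : E → ℝ}
    (h : IsLerayProfile ν a U P) (hU3 : ContDiff ℝ 3 U) (hP2 : ContDiff ℝ 2 P) (y : E) :
    (Δ P) y = -traceCLM ((fderiv ℝ U y).comp (fderiv ℝ U y)) := by
  have hU2 : ContDiff ℝ 2 U := hU3.of_le (by norm_num)
  have hU1 : ContDiff ℝ 1 U := hU3.of_le (by norm_num)
  have hUd : Differentiable ℝ U := hU1.differentiable one_ne_zero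
  have hDUd : Differentiable ℝ (fderiv ℝ U) :=
    (hU2.fderiv_right (m := 1) le_rfl).differentiable one_ne_zero
  have hgradP : gradient P =
      fun x => ν • (Δ U) x - a • U x - a • fderiv ℝ U x x - convect U U x := by
    funext x
    have hx := h.profile_eq x
    rw [← sub_eq_zero, ← hx]
    abel
  rw [← divergence_gradient hP2 y, hgradP]
  have hdA : DifferentiableAt ℝ (fun x => ν • (Δ U) x) y :=
    ((differentiable_laplacian hU3) y).const_smul ν
  have hdB : DifferentiableAt ℝ (fun x => a • U x) y := (hUd y).const_smul a
  have hdC' : DifferentiableAt ℝ (fun x => fderiv ℝ U x x) y :=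
    (hDUd y).clm_apply differentiableAt_fun_id
  have hdC : DifferentiableAt ℝ (fun x => a • fderiv ℝ U x x) y := hdC'.const_smul a
  have hdD : DifferentiableAt ℝ (convect U U) y := (hDUd y).clm_apply (hUd y)
  have hdAB : DifferentiableAt ℝ (fun x => ν • (Δ U) x - a • U x) y := hdA.sub hdB
  have hdABC : DifferentiableAt ℝ (fun x => ν • (Δ U) x - a • U x - a • fderiv ℝ U x x) y :=
    hdAB.sub hdC
  rw [divergence_sub_apply hdABC hdD, divergence_sub_apply hdAB hdC,
    divergence_sub_apply hdA hdB, divergence_const_smul_apply ((differentiable_laplacian hU3) y),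
    divergence_const_smul_apply (hUd y), divergence_const_smul_apply hdC',
    divergence_laplacian_eq_zero hU3 h.divFree, h.divFree y,
    divergence_fderiv_apply_self_eq_zero hU2 h.divFree, divergence_convect_self_eq hU2 h.divFree]
  ring

/-- The Laplacian of a `C³` field is `C¹`. [folklore] -/
theorem contDiff_one_laplacian {F' : Type*} [NormedAddCommGroup F'] [InnerProductSpace ℝ F']
    {v : E → F'} (hv : ContDiff ℝ 3 v) : ContDiff ℝ 1 (Δ v) := by
  set b := stdOrthonormalBasis ℝ E
  have hDi : ∀ c : E, ContDiff ℝ 2 (fun y => fderiv ℝ v y c) := fun c =>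
    (hv.fderiv_right (m := 2) le_rfl).clm_apply contDiff_const
  have hDii : ∀ c : E, ContDiff ℝ 1 (fun y => fderiv ℝ (fun z => fderiv ℝ v z c) y c) := fun c =>
    ((hDi c).fderiv_right (m := 1) le_rfl).clm_apply contDiff_const
  have hΔ : Δ v = fun y => ∑ i, fderiv ℝ (fun z => fderiv ℝ v z (b i)) y (b i) :=
    funext fun y => laplacian_eq_sum_fderiv_fderiv b (hv.of_le (by norm_num)) y
  rw [hΔ]
  exact ContDiff.sum fun i _ => hDii (b i)

/-- **The pressure of a Leray profile is `C²` when the velocity is `C³`**: by the profile system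
`∇P = νΔU − aU − a(y·∇)U − (U·∇)U ∈ C¹` (Tsai 1998, p. 34: "Since `U` is smooth, `P` is also
smooth"). [cite: Tsai1998, §2 (p. 34)] -/
theorem IsLerayProfile.contDiff_two_pressure {ν a : ℝ} {U : E → E} {P : E → ℝ}
    (h : IsLerayProfile ν a U P) (hU3 : ContDiff ℝ 3 U) : ContDiff ℝ 2 P := by
  have hU2 : ContDiff ℝ 2 U := hU3.of_le (by norm_num)
  have hU1 : ContDiff ℝ 1 U := hU3.of_le (by norm_num)
  have hDU2 : ContDiff ℝ 2 (fderiv ℝ U) := hU3.fderiv_right (m := 2) le_rfl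
  have hG : ContDiff ℝ 1 fun x => ν • (Δ U) x - a • U x - a • fderiv ℝ U x x - convect U U x := by
    have hA : ContDiff ℝ 1 fun x => ν • (Δ U) x := contDiff_const.smul (contDiff_one_laplacian hU3)
    have hB : ContDiff ℝ 1 fun x => a • U x := contDiff_const.smul hU1
    have hC : ContDiff ℝ 1 fun x => a • fderiv ℝ U x x :=
      contDiff_const.smul ((hDU2.clm_apply contDiff_id).of_le one_le_two)
    have hD : ContDiff ℝ 1 (convect U U) := (hDU2.clm_apply hU2).of_le one_le_two
    exact ((hA.sub hB).sub hC).sub hD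
  have hgradP : gradient P =
      fun x => ν • (Δ U) x - a • U x - a • fderiv ℝ U x x - convect U U x := by
    funext x
    have hx := h.profile_eq x
    rw [← sub_eq_zero, ← hx]
    abel
  have hfd : fderiv ℝ P = fun x => InnerProductSpace.toDual ℝ E (gradient P x) := by
    funext x
    simp [gradient]
  rw [show (2 : WithTop ℕ∞) = 1 + 1 from rfl, contDiff_succ_iff_fderiv]
  refine ⟨(h.contDiff_pressure).differentiable one_ne_zero, fun h => absurd h (by simp), ?_⟩
  rw [hfd, hgradP]
  exact (InnerProductSpace.toDual ℝ E).contDiff.comp hG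

end Profiles

/-! ## Growth bookkeeping -/

section Growth

variable {E : Type*} [NormedAddCommGroup E] [InnerProductSpace ℝ E] [FiniteDimensional ℝ E]

/-- A continuous field with `|U(y)| ≤ b|y|` for `|y| ≥ r₀` admits an affine bound
`|U(y)| ≤ M + b|y|` everywhere (compactness of the closed ball). [folklore] -/
theorem exists_affine_bound_of_eventually_le {U : E → E} (hUc : Continuous U) {b r₀ : ℝ}
    (hU : ∀ y, r₀ ≤ ‖y‖ → ‖U y‖ ≤ b * ‖y‖) : ∃ M : ℝ, 0 ≤ M ∧ ∀ y, ‖U y‖ ≤ M + b * ‖y‖ := by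
  obtain ⟨M, hM⟩ : ∃ M, ∀ z ∈ closedBall (0 : E) r₀, ‖U z‖ ≤ M :=
    (isCompact_closedBall (0 : E) r₀).exists_bound_of_continuousOn hUc.continuousOn
  refine ⟨max M 0 + |b| * |r₀|, by positivity, fun z => ?_⟩
  by_cases hz : r₀ ≤ ‖z‖
  · exact (hU z hz).trans (le_add_of_nonneg_left (by positivity))
  · have hz' : z ∈ closedBall (0 : E) r₀ := by
      rw [mem_closedBall, dist_zero_right]; exact (not_le.1 hz).le
    have hzr : ‖z‖ ≤ |r₀| := ((not_le.1 hz).le).trans (le_abs_self _)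
    have h1 : -(b * ‖z‖) ≤ |b| * |r₀| := by
      calc -(b * ‖z‖) ≤ |b * ‖z‖| := neg_le_abs _
        _ = |b| * ‖z‖ := by rw [abs_mul, abs_norm]
        _ ≤ |b| * |r₀| := by gcongr
    calc ‖U z‖ ≤ M := hM z hz'
      _ ≤ max M 0 := le_max_left _ _
      _ ≤ max M 0 + |b| * |r₀| + b * ‖z‖ := by linarith

/-- A continuous function with `|P(y)| ≤ C|y|^N` for `|y| ≥ R` satisfies `|P(y)| ≤ C'(1 + |y|)^N`
everywhere. [folklore] -/
theorem exists_poly_bound_of_eventually_le {P : E → ℝ} (hPc : Continuous P) {C R : ℝ} {N : ℕ}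
    (hP : ∀ y, R ≤ ‖y‖ → |P y| ≤ C * ‖y‖ ^ N) :
    ∃ C' : ℝ, 0 ≤ C' ∧ ∀ y, |P y| ≤ C' * (1 + ‖y‖) ^ N := by
  obtain ⟨M, hM⟩ : ∃ M, ∀ z ∈ closedBall (0 : E) R, ‖P z‖ ≤ M :=
    (isCompact_closedBall (0 : E) R).exists_bound_of_continuousOn hPc.continuousOn
  refine ⟨max M 0 + |C|, by positivity, fun y => ?_⟩
  have h1 : 1 ≤ (1 + ‖y‖) ^ N := one_le_pow₀ (by linarith [norm_nonneg y])
  by_cases hy : R ≤ ‖y‖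
  · calc |P y| ≤ C * ‖y‖ ^ N := hP y hy
      _ ≤ |C| * (1 + ‖y‖) ^ N := by
          refine (le_abs_self _).trans ?_
          rw [abs_mul, abs_pow, abs_norm]
          gcongr
          linarith [norm_nonneg y]
      _ ≤ (max M 0 + |C|) * (1 + ‖y‖) ^ N := by
          gcongr
          linarith [le_max_right M 0]
  · have hy' : y ∈ closedBall (0 : E) R := by
      rw [mem_closedBall, dist_zero_right]; exact (not_le.1 hy).le
    calc |P y| = ‖P y‖ := (Real.norm_eq_abs _).symm
      _ ≤ M := hM y hy'
      _ ≤ max M 0 + |C| := (le_max_left _ _).trans (le_add_of_nonneg_right (abs_nonneg _))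
      _ ≤ (max M 0 + |C|) * (1 + ‖y‖) ^ N := le_mul_of_one_le_right (by positivity) h1

end Growth

end Literature.Analysis.FluidPDE

end
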